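import Mathlib

/-!
# Stub `stub_witness_r3` — the `(r, N, d) = (3, 7, 2)` gapped-Toeplitz corner certificate

Crux `HiddenCorners` (stmt-MatrixMultiplication-7492), line `Sketch`.  The smallest member of the
line's design family (the `r = 3` analogue of the route's `r = 2` proof of concept
`ToeplitzCornerTwo` at `(2, 4, 1)`): rows `ρ = (−2, −1, 0, 1, 2, 3, 4)` (`ρ i = i − 2`), columns
`γ = (−10, −5, −4, −3, −2, −1, 0)` (the break `−10 ↦ −5` gives the second column break), symbol
`t_(a + 5 b) = X a b`, i.e. the pencil coefficients are the 0/1 matrices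
`T a b i j = [ρ i − γ j = a + 5 b]`.  Writing `xab = X a b`, the pencil `T(X) = ∑ X a b • T a b` is

  row 0: [0,   0,   x20, x10, x00, 0,   0  ]
  row 1: [0,   0,   0,   x20, x10, x00, 0  ]
  row 2: [x02, x01, 0,   0,   x20, x10, x00]
  row 3: [x12, x11, x01, 0,   0,   x20, x10]
  row 4: [x22, x21, x11, x01, 0,   0,   x20]
  row 5: [0,   0,   x21, x11, x01, 0,   0  ]
  row 6: [0,   0,   0,   x21, x11, x01, 0  ]

* Displacement (`d = 2`): with the lower shift `Z`, `T a b − Z (T a b) Zᵀ` is supported on row `0`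
  and columns `0, 1`, so `T a b − Z (T a b) Zᵀ = G₀ (H₁ a b)ᵀ + (G₁ a b) H₀ᵀ` with `G₀ = [e₀ | 0]`,
  `H₀ = [e₀ | e₁]`, `H₁ a b = [(row 0 of T a b)ᵀ | 0]`, `G₁ a b` = columns `0, 1` of the
  displacement with row `0` removed.
* Corner: `E = [e₆ | e₁ | e₀]`, `F = [e₂ | e₃ | e₄]` (both with orthonormal columns, rank `3`) and
  `T a b E = F E_ab`, hence `T(X) E = F X` by linearity.
* Nonsingularity: `X₀ = E₂₀ + E₀₁ + E₁₂` gives a 0/1 matrix `T(X₀)` with a unique perfect matching;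
  we certify `det T(X₀) ≠ 0` by an explicit signed 0/1 inverse `P`, `T(X₀) P = 1`.
* Singular on singular `X`: a kernel vector `v ≠ 0` of `X` gives the kernel vector `E v ≠ 0` of
  `T(X)` (`Eᵀ E = 1`).

All finite verifications are integer matrix identities checked by `decide` (`facts_int`, which also
packages the integer data existentially, so the file has no definitions); the complex statements
follow by functoriality of `Matrix.map (Int.castRingHom ℂ)` (the `*_of` transfer lemmas).
-/

set_option linter.dupNamespace false

namespace Summit.MatrixMultiplication.MatrixMultiplication.Cruxes.HiddenCorners.Sketch

open scoped BigOperators Matrix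

/-! ### The finite verifications (kernel `decide` over `ℤ`) -/

/-- The integer data and its five finite identities.  With `Tz a b i j = [ρ i − γ j = a + 5 b]`
(`ρ i = i − 2`, `γ = (−10, −5, −4, −3, −2, −1, 0)`), the integer lower shift `Zz`,
`G₀ = [e₀ | 0]`, `H₀ = [e₀ | e₁]`, `H₁ a b = [(row 0 of Tz a b)ᵀ | 0]`, `G₁ a b` = columns `0, 1`
of `Tz a b − Zz (Tz a b) Zzᵀ` with row `0` zeroed, `Ez = [e₆ | e₁ | e₀]`, `Fz = [e₂ | e₃ | e₄]`,
`X₀ = E₂₀ + E₀₁ + E₁₂` and the signed 0/1 matrix `P = T(X₀)⁻¹`: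
the nine displacement identities, the nine corner identities `Tz a b Ez = Fz E_ab`, the Gram
identities `Ezᵀ Ez = Fzᵀ Fz = 1`, and the inverse certificate `T(X₀) P = 1`. -/
private theorem facts_int :
    ∃ (Tz : Fin 3 → Fin 3 → Matrix (Fin 7) (Fin 7) ℤ) (Zz : Matrix (Fin 7) (Fin 7) ℤ)
      (G₀ H₀ : Matrix (Fin 7) (Fin 2) ℤ) (G₁ H₁ : Fin 3 → Fin 3 → Matrix (Fin 7) (Fin 2) ℤ)
      (Ez Fz : Matrix (Fin 7) (Fin 3) ℤ) (X₀ : Matrix (Fin 3) (Fin 3) ℤ)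
      (P : Matrix (Fin 7) (Fin 7) ℤ),
      Zz = (Matrix.of fun i j : Fin 7 => if (i : ℕ) = (j : ℕ) + 1 then (1 : ℤ) else 0) ∧
      (∀ a b, Tz a b - Zz * Tz a b * Zzᵀ = G₀ * (H₁ a b)ᵀ + G₁ a b * H₀ᵀ) ∧
      (∀ a b, Tz a b * Ez = Fz * Matrix.single a b (1 : ℤ)) ∧
      Ezᵀ * Ez = 1 ∧ Fzᵀ * Fz = 1 ∧
      (∑ a : Fin 3, ∑ b : Fin 3, X₀ a b • Tz a b) * P = 1 := by
  let γ : Fin 7 → ℤ := ![-10, -5, -4, -3, -2, -1, 0]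
  let Tz : Fin 3 → Fin 3 → Matrix (Fin 7) (Fin 7) ℤ := fun a b =>
    Matrix.of fun i j => if (i : ℤ) - 2 - γ j = (a : ℤ) + 5 * (b : ℤ) then 1 else 0
  let Zz : Matrix (Fin 7) (Fin 7) ℤ :=
    Matrix.of fun i j => if (i : ℕ) = (j : ℕ) + 1 then 1 else 0
  let G₀ : Matrix (Fin 7) (Fin 2) ℤ :=
    Matrix.of fun i k => if (i : ℕ) = 0 ∧ (k : ℕ) = 0 then 1 else 0
  let H₀ : Matrix (Fin 7) (Fin 2) ℤ := Matrix.of fun j k => if (j : ℕ) = (k : ℕ) then 1 else 0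
  let H₁ : Fin 3 → Fin 3 → Matrix (Fin 7) (Fin 2) ℤ := fun a b =>
    Matrix.of fun j k => if (k : ℕ) = 0 then Tz a b 0 j else 0
  let G₁ : Fin 3 → Fin 3 → Matrix (Fin 7) (Fin 2) ℤ := fun a b =>
    Matrix.of fun i k =>
      if (i : ℕ) = 0 then 0 else (Tz a b - Zz * Tz a b * Zzᵀ) i (k.castLE (by norm_num))
  let Ez : Matrix (Fin 7) (Fin 3) ℤ := Matrix.of fun j c => if j = ![6, 1, 0] c then 1 else 0
  let Fz : Matrix (Fin 7) (Fin 3) ℤ := Matrix.of fun i a => if i = ![2, 3, 4] a then 1 else 0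
  let X₀ : Matrix (Fin 3) (Fin 3) ℤ :=
    Matrix.of fun a b => if (b : ℕ) = ((a : ℕ) + 1) % 3 then 1 else 0
  let P : Matrix (Fin 7) (Fin 7) ℤ :=
    !![-1, 0, 0, 1, 0, 0, -1;
        0, 0, 1, 0, 0, -1, 0;
        1, 0, 0, 0, 0, 0, 0;
        0, 1, 0, 0, 0, 0, 0;
        0, 0, 0, 0, 0, 1, 0;
        0, 0, 0, 0, 0, 0, 1;
        0, -1, 0, 0, 1, 0, 0]
  refine ⟨Tz, Zz, G₀, H₀, G₁, H₁, Ez, Fz, X₀, P, rfl, ?_, ?_, ?_, ?_, ?_⟩ <;> decide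

/-! ### Transfer to `ℂ` -/

/-- The complex lower shift of the statement is the cast of the integer lower shift. -/
private theorem shift_cast :
    (Matrix.of fun i j : Fin 7 => if (i : ℕ) = (j : ℕ) + 1 then (1 : ℂ) else 0) =
      (Matrix.of fun i j : Fin 7 => if (i : ℕ) = (j : ℕ) + 1 then (1 : ℤ) else 0).map
        (Int.castRingHom ℂ) := by
  ext i j
  simp only [Matrix.map_apply, Matrix.of_apply]
  split_ifs <;> simp

/-- Transfer of a displacement identity with split generators from `ℤ` to `ℂ`. -/
private theorem disp_of {Tz Zz : Matrix (Fin 7) (Fin 7) ℤ} {G₀ H₀ G₁ H₁ : Matrix (Fin 7) (Fin 2) ℤ}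
    (h : Tz - Zz * Tz * Zzᵀ = G₀ * H₁ᵀ + G₁ * H₀ᵀ) :
    Tz.map (Int.castRingHom ℂ)
        - Zz.map (Int.castRingHom ℂ) * Tz.map (Int.castRingHom ℂ) * (Zz.map (Int.castRingHom ℂ))ᵀ
      = G₀.map (Int.castRingHom ℂ) * (H₁.map (Int.castRingHom ℂ))ᵀ
        + G₁.map (Int.castRingHom ℂ) * (H₀.map (Int.castRingHom ℂ))ᵀ := by
  have h' : (Tz - Zz * Tz * Zzᵀ).map (Int.castRingHom ℂ)
      = (G₀ * H₁ᵀ + G₁ * H₀ᵀ).map (Int.castRingHom ℂ) := by rw [h]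
  rw [Matrix.map_sub _ (map_sub (Int.castRingHom ℂ)),
    Matrix.map_add _ (map_add (Int.castRingHom ℂ))] at h'
  simpa only [Matrix.map_mul, Matrix.transpose_map] using h'

/-- A `7 × 3` integer matrix with orthonormal columns: its cast `A` satisfies `Aᵀ A = 1` and has
complex rank `3`. -/
private theorem gram_of {Az : Matrix (Fin 7) (Fin 3) ℤ} (h : Azᵀ * Az = 1) :
    (Az.map (Int.castRingHom ℂ))ᵀ * Az.map (Int.castRingHom ℂ) = 1 ∧
      (Az.map (Int.castRingHom ℂ)).rank = 3 := by
  have h' : (Az.map (Int.castRingHom ℂ))ᵀ * Az.map (Int.castRingHom ℂ) = 1 := by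
    rw [← Matrix.transpose_map, ← Matrix.map_mul, h,
      Matrix.map_one _ (map_zero (Int.castRingHom ℂ)) (map_one (Int.castRingHom ℂ))]
  refine ⟨h', le_antisymm (Matrix.rank_le_width _) ?_⟩
  calc 3 = ((Az.map (Int.castRingHom ℂ))ᵀ * Az.map (Int.castRingHom ℂ)).rank := by
        rw [h', Matrix.rank_one, Fintype.card_fin]
    _ ≤ (Az.map (Int.castRingHom ℂ)).rank := Matrix.rank_mul_le_right _ _

/-- The corner identity `T(X) E = F X` over `ℂ`, by linearity from the nine integer identities
`Tz a b Ez = Fz E_ab`. -/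
private theorem corner_of {Tz : Fin 3 → Fin 3 → Matrix (Fin 7) (Fin 7) ℤ}
    {Ez Fz : Matrix (Fin 7) (Fin 3) ℤ} (h : ∀ a b, Tz a b * Ez = Fz * Matrix.single a b (1 : ℤ))
    (X : Matrix (Fin 3) (Fin 3) ℂ) :
    (∑ a : Fin 3, ∑ b : Fin 3, X a b • (Tz a b).map (Int.castRingHom ℂ))
        * Ez.map (Int.castRingHom ℂ) = Fz.map (Int.castRingHom ℂ) * X := by
  have hab : ∀ a b : Fin 3, (Tz a b).map (Int.castRingHom ℂ) * Ez.map (Int.castRingHom ℂ)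
      = Fz.map (Int.castRingHom ℂ) * Matrix.single a b (1 : ℂ) := by
    intro a b
    have h' : (Tz a b * Ez).map (Int.castRingHom ℂ)
        = (Fz * Matrix.single a b (1 : ℤ)).map (Int.castRingHom ℂ) := by rw [h]
    simpa only [Matrix.map_mul, Matrix.map_single, map_one] using h'
  calc (∑ a : Fin 3, ∑ b : Fin 3, X a b • (Tz a b).map (Int.castRingHom ℂ))
          * Ez.map (Int.castRingHom ℂ)
        = ∑ a : Fin 3, ∑ b : Fin 3,
            X a b • (Fz.map (Int.castRingHom ℂ) * Matrix.single a b (1 : ℂ)) := by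
          simp only [Matrix.sum_mul, Matrix.smul_mul, hab]
    _ = Fz.map (Int.castRingHom ℂ)
          * ∑ a : Fin 3, ∑ b : Fin 3, X a b • Matrix.single a b (1 : ℂ) := by
          simp only [Matrix.mul_sum, Matrix.mul_smul]
    _ = Fz.map (Int.castRingHom ℂ) * X := by
          congr 1
          simp only [Matrix.smul_single, smul_eq_mul, mul_one]
          exact (Matrix.matrix_eq_sum_single X).symm

/-- `det T(X₀) ≠ 0` over `ℂ` from an integer inverse certificate `T(X₀) P = 1`. -/
private theorem det_ne_zero_of {Tz : Fin 3 → Fin 3 → Matrix (Fin 7) (Fin 7) ℤ}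
    {X₀ : Matrix (Fin 3) (Fin 3) ℤ} {P : Matrix (Fin 7) (Fin 7) ℤ}
    (h : (∑ a : Fin 3, ∑ b : Fin 3, X₀ a b • Tz a b) * P = 1) :
    (∑ a : Fin 3, ∑ b : Fin 3,
      (X₀.map (Int.castRingHom ℂ)) a b • (Tz a b).map (Int.castRingHom ℂ)).det ≠ 0 := by
  have hmap : (∑ a : Fin 3, ∑ b : Fin 3,
        (X₀.map (Int.castRingHom ℂ)) a b • (Tz a b).map (Int.castRingHom ℂ))
      = (∑ a : Fin 3, ∑ b : Fin 3, X₀ a b • Tz a b).map (Int.castRingHom ℂ) := by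
    ext i j
    simp only [Matrix.sum_apply, Matrix.smul_apply, Matrix.map_apply, smul_eq_mul, map_sum,
      map_mul]
  have h1 : (∑ a : Fin 3, ∑ b : Fin 3, X₀ a b • Tz a b).map (Int.castRingHom ℂ)
      * P.map (Int.castRingHom ℂ) = 1 := by
    rw [← Matrix.map_mul, h,
      Matrix.map_one _ (map_zero (Int.castRingHom ℂ)) (map_one (Int.castRingHom ℂ))]
  have h2 := congrArg Matrix.det h1
  rw [Matrix.det_mul, Matrix.det_one] at h2
  rw [hmap]
  exact left_ne_zero_of_mul_eq_one h2

/-- The corner criterion for this instance: if `Eᵀ E = 1` and `T(X) E = F X` for all `X`, then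
`T(X)` is singular whenever `X` is (a kernel vector `v ≠ 0` of `X` gives the kernel vector
`E v ≠ 0` of `T(X)`). -/
private theorem singular_of {T : Fin 3 → Fin 3 → Matrix (Fin 7) (Fin 7) ℂ}
    {E F : Matrix (Fin 7) (Fin 3) ℂ} (hE : Eᵀ * E = 1)
    (hc : ∀ X : Matrix (Fin 3) (Fin 3) ℂ, (∑ a : Fin 3, ∑ b : Fin 3, X a b • T a b) * E = F * X)
    (X : Matrix (Fin 3) (Fin 3) ℂ) (hX : X.det = 0) :
    (∑ a : Fin 3, ∑ b : Fin 3, X a b • T a b).det = 0 := by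
  obtain ⟨v, hv0, hXv⟩ := Matrix.exists_mulVec_eq_zero_iff.mpr hX
  refine Matrix.exists_mulVec_eq_zero_iff.mp ⟨E *ᵥ v, ?_, ?_⟩
  · intro hEv
    apply hv0
    calc v = (Eᵀ * E) *ᵥ v := by rw [hE, Matrix.one_mulVec]
      _ = 0 := by rw [← Matrix.mulVec_mulVec, hEv, Matrix.mulVec_zero]
  · rw [Matrix.mulVec_mulVec, hc X, ← Matrix.mulVec_mulVec, hXv, Matrix.mulVec_zero]

/-- **Stub `stub_witness_r3`** — the `(r, N, d) = (3, 7, 2)` gapped-Toeplitz corner certificate: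
pencil coefficients `T a b i j = [ρ i − γ j = a + 5 b]` with rows `ρ = [−2, 4]` and columns
`γ = {−10} ∪ [−5, 0]`; split Stein generators of length `2`; rank-`3` unit frames
`E = [e₆ | e₁ | e₀]`, `F = [e₂ | e₃ | e₄]` with `T(X) E = F X`; `det T(X₀) ≠ 0` at
`X₀ = E₂₀ + E₀₁ + E₁₂`; and `T(X)` is singular whenever `X` is. -/
theorem stub_witness_r3 : ∃ (T : Fin 3 → Fin 3 → Matrix (Fin 7) (Fin 7) ℂ),
    (∃ (G₀ H₀ : Matrix (Fin 7) (Fin 2) ℂ) (G₁ H₁ : Fin 3 → Fin 3 → Matrix (Fin 7) (Fin 2) ℂ),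
      ∀ a b, T a b - (Matrix.of fun i j : Fin 7 => if (i : ℕ) = (j : ℕ) + 1 then (1 : ℂ) else 0) * T a b *
        (Matrix.of fun i j : Fin 7 => if (i : ℕ) = (j : ℕ) + 1 then (1 : ℂ) else 0)ᵀ
          = G₀ * (H₁ a b)ᵀ + G₁ a b * H₀ᵀ) ∧
    (∃ E F : Matrix (Fin 7) (Fin 3) ℂ, E.rank = 3 ∧ F.rank = 3 ∧
      ∀ X : Matrix (Fin 3) (Fin 3) ℂ, (∑ a : Fin 3, ∑ b : Fin 3, X a b • T a b) * E = F * X) ∧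
    (∃ X₀ : Matrix (Fin 3) (Fin 3) ℂ, (∑ a : Fin 3, ∑ b : Fin 3, X₀ a b • T a b).det ≠ 0) ∧
    ∀ X : Matrix (Fin 3) (Fin 3) ℂ, X.det = 0 → (∑ a : Fin 3, ∑ b : Fin 3, X a b • T a b).det = 0 := by
  obtain ⟨Tz, Zz, G₀, H₀, G₁, H₁, Ez, Fz, X₀, P, hZ, hdisp, hcorner, hE, hF, hinv⟩ := facts_int
  subst hZ
  refine ⟨fun a b => (Tz a b).map (Int.castRingHom ℂ),
    ⟨G₀.map (Int.castRingHom ℂ), H₀.map (Int.castRingHom ℂ),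
      fun a b => (G₁ a b).map (Int.castRingHom ℂ), fun a b => (H₁ a b).map (Int.castRingHom ℂ),
      fun a b => ?_⟩,
    ⟨Ez.map (Int.castRingHom ℂ), Fz.map (Int.castRingHom ℂ), (gram_of hE).2, (gram_of hF).2,
      corner_of hcorner⟩,
    ⟨X₀.map (Int.castRingHom ℂ), det_ne_zero_of hinv⟩,
    singular_of (gram_of hE).1 (corner_of hcorner)⟩
  rw [shift_cast]
  exact disp_of (hdisp a b)

end Summit.MatrixMultiplication.MatrixMultiplication.Cruxes.HiddenCorners.Sketch
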